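import Mathlib
import HarnessLib
import Literature.Analysis.ODE.RegularLevelCurves
import Literature.Analysis.ODE.RegularLevelCurvesFlowBox

/-!
# Route `LoopPeriodRatchet`, support `NoPlanarExtremum` (stmt-NavierStokesRegularity-22880) — helper II:
# a bounded regular level curve in `ℝ³` carries a periodic orbit of its tangent field

Support file (`--supports` the item; it does not close it). Second ingredient of the planned proof of
`NoPlanarExtremum` (a strict planar extremum of the stream function is ringed by a regular closed level curve,
which is a non-stationary periodic orbit of `y′ = curl v(s)(y)`): the passage from a REGULAR, BOUNDED level
curve to a periodic orbit, imported from the tree's Khovanskii files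
(`Literature.Analysis.ODE.LevelCurveData`: trajectories of the renormalised tangent field on a regular level
curve `Γ = H⁻¹(0) ⊆ ℝ^{d+1}` are injective or periodic, and injective ones are proper), transported to
`EuclideanSpace ℝ (Fin 3)` and freed of the renormalisation:

* `exists_periodic_orbit_of_scaled` — TIME CHANGE: if `β′ = κ(t) W(β)` with `κ > 0` continuous and `β, κ`
  `T₀`-periodic, then `γ = β ∘ σ`, `σ` the inverse of `τ(t) = ∫₀ᵗ κ`, solves `γ′ = W(γ)` and is periodic with
  period `ℓ = τ(T₀) > 0`, `γ 0 = β 0`, `range γ ⊆ range β`;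
* `exists_scaled_periodic_of_regular_level` — for `H : ℝ³ → ℝ²`, `V : ℝ³ → ℝ³` of class `C¹` with
  `dH(V) ≡ 0`, `V ≠ 0` and `dH` onto along `Γ = {H = 0}`, and `Γ` BOUNDED, through every `p ∈ Γ` passes a
  periodic solution of `β′ = κ(t) V(β)` (`κ > 0` continuous periodic) inside `Γ` (the injective alternative is
  excluded because injective trajectories leave every ball, `LevelCurveData.tendsto_norm_traj_atTop`);
* `exists_periodic_orbit_of_regular_level` — hence a periodic orbit `γ′ = V(γ)`, `γ 0 = p`, `γ ⊆ Γ`.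

Not a claim about Navier–Stokes: ODE plumbing for the D-0145 line `LoopPeriodRatchet` (door rung
N0-LocalTubeDoorPoloidal; no summit, no Clay option). Sources: A. G. Khovanskii, *Fewnomials* (1991), Ch. III
(phase curves of a non-vanishing field on a regular curve are lines or circles); P. Hartman, *ODE* (2002),
Ch. II (continuation).
-/

noncomputable section

-- the summit and its single sub-problem share the name (CONVENTIONS §1), as in every Theorems file
set_option linter.dupNamespace false

namespace Summit.NavierStokesRegularity.NavierStokesRegularity.Theorems.LoopPeriodRatchetNoPlanarExtremumOrbit

open MeasureTheory Set Function Filter Topology Metric intervalIntegral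
open Literature.Analysis.ODE

/-! ### Time change: from `β′ = κ W(β)` to `γ′ = W(γ)` -/

/-- **Time change.** Let `β′(t) = κ(t) • W(β(t))` on `ℝ` with `κ` continuous and positive, and let `β` and
`κ` be `T₀`-periodic, `T₀ > 0`. Then there is a periodic solution `γ` of `γ′ = W(γ)` with a period `ℓ > 0`,
`γ 0 = β 0`, whose range is contained in the range of `β` (`γ = β ∘ σ`, `σ` the inverse of `t ↦ ∫₀ᵗ κ`). -/
theorem exists_periodic_orbit_of_scaled {F : Type*} [NormedAddCommGroup F] [NormedSpace ℝ F]
    {W : F → F} {β : ℝ → F} {κ : ℝ → ℝ} (hκc : Continuous κ) (hκ : ∀ t, 0 < κ t)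
    (hβ : ∀ t, HasDerivAt β (κ t • W (β t)) t) {T₀ : ℝ} (hT₀ : 0 < T₀)
    (hβper : ∀ t, β (t + T₀) = β t) (hκper : ∀ t, κ (t + T₀) = κ t) :
    ∃ γ : ℝ → F, ∃ ℓ : ℝ, 0 < ℓ ∧ (∀ θ, HasDerivAt γ (W (γ θ)) θ) ∧ (∀ θ, γ (θ + ℓ) = γ θ) ∧
      γ 0 = β 0 ∧ (∀ θ, ∃ t, γ θ = β t) := by
  -- the clock `τ(t) = ∫₀ᵗ κ`
  set τ : ℝ → ℝ := fun t => ∫ s in (0 : ℝ)..t, κ s with hτ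
  have hκi : ∀ a b : ℝ, IntervalIntegrable κ volume a b := fun a b => hκc.intervalIntegrable a b
  have hτd : ∀ t, HasDerivAt τ (κ t) t := fun t => (hκc.integral_hasStrictDerivAt 0 t).hasDerivAt
  have hτc : Continuous τ := continuous_iff_continuousAt.2 fun t => (hτd t).continuousAt
  have hτ0 : τ 0 = 0 := by simp [hτ]
  have hτmono : StrictMono τ :=
    strictMono_of_deriv_pos fun t => by rw [(hτd t).deriv]; exact hκ t
  set ℓ : ℝ := τ T₀ with hℓ
  have hℓ0 : 0 < ℓ := intervalIntegral_pos_of_pos_on (hκi 0 T₀) (fun t _ => hκ t) hT₀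
  -- `τ (t + T₀) = τ t + ℓ`
  have hτadd : ∀ t, τ (t + T₀) = τ t + ℓ := by
    intro t
    have h1 : ∫ s in (0 : ℝ)..t + T₀, κ s = (∫ s in (0 : ℝ)..T₀, κ s) + ∫ s in T₀..t + T₀, κ s :=
      (integral_add_adjacent_intervals (hκi 0 T₀) (hκi T₀ (t + T₀))).symm
    have h2 : ∫ s in T₀..t + T₀, κ s = ∫ s in (0 : ℝ)..t, κ s := by
      have h := intervalIntegral.integral_comp_add_right (fun s => κ s) (a := 0) (b := t) T₀
      rw [zero_add] at h
      rw [← h]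
      exact intervalIntegral.integral_congr fun s _ => hκper s
    change ∫ s in (0 : ℝ)..t + T₀, κ s = (∫ s in (0 : ℝ)..t, κ s) + ∫ s in (0 : ℝ)..T₀, κ s
    rw [h1, h2, add_comm]
  -- `τ` at the multiples of `T₀`, hence `τ → ±∞`
  have hτnat : ∀ n : ℕ, τ (n * T₀) = n * ℓ ∧ τ (-(n * T₀)) = -(n * ℓ) := by
    intro n
    induction n with
    | zero => simp [hτ0]
    | succ n ih =>
      constructor
      · rw [Nat.cast_succ, add_mul, one_mul, hτadd, ih.1, add_mul, one_mul]
      · have h := hτadd (-((n + 1 : ℕ) * T₀))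
        rw [show -(((n + 1 : ℕ) : ℝ) * T₀) + T₀ = -((n : ℝ) * T₀) by push_cast; ring] at h
        have ih2 := ih.2
        push_cast at h ih2 ⊢
        linarith
  have htop : Tendsto τ atTop atTop := by
    refine tendsto_atTop_atTop.2 fun b => ?_
    obtain ⟨n, hn⟩ := exists_nat_ge (b / ℓ)
    refine ⟨n * T₀, fun a ha => ?_⟩
    have h1 : b ≤ n * ℓ := by rw [div_le_iff₀ hℓ0] at hn; exact hn
    exact h1.trans ((hτnat n).1 ▸ hτmono.monotone ha)
  have hbot : Tendsto τ atBot atBot := by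
    refine tendsto_atBot_atBot.2 fun b => ?_
    obtain ⟨n, hn⟩ := exists_nat_ge (-b / ℓ)
    refine ⟨-(n * T₀), fun a ha => ?_⟩
    have h1 : -(n * ℓ) ≤ b := by rw [div_le_iff₀ hℓ0] at hn; linarith
    exact ((hτnat n).2 ▸ hτmono.monotone ha).trans h1
  have hsurj : Function.Surjective τ := hτc.surjective htop hbot
  -- the inverse clock `σ`
  set Φ : ℝ ≃o ℝ := hτmono.orderIsoOfSurjective τ hsurj with hΦ
  set σ : ℝ → ℝ := fun θ => Φ.symm θ with hσ
  have hΦapply : ∀ t, Φ t = τ t := fun t => rfl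
  have hτσ : ∀ θ, τ (σ θ) = θ := fun θ => by rw [← hΦapply]; exact Φ.apply_symm_apply θ
  have hστ : ∀ t, σ (τ t) = t := fun t => by
    have := Φ.symm_apply_apply t; rwa [hΦapply] at this
  have hσc : Continuous σ := Φ.symm.continuous
  have hσd : ∀ θ, HasDerivAt σ (κ (σ θ))⁻¹ θ := fun θ =>
    HasDerivAt.of_local_left_inverse hσc.continuousAt (hτd (σ θ)) (hκ _).ne'
      (Eventually.of_forall hτσ)
  have hσ0 : σ 0 = 0 := by have := hστ 0; rwa [hτ0] at this
  have hσadd : ∀ θ, σ (θ + ℓ) = σ θ + T₀ := fun θ =>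
    hτmono.injective (by rw [hτσ, hτadd, hτσ])
  -- the reparametrised orbit
  refine ⟨fun θ => β (σ θ), ℓ, hℓ0, fun θ => ?_, fun θ => ?_, by simp only [hσ0], fun θ => ⟨σ θ, rfl⟩⟩
  · have h := (hβ (σ θ)).scomp θ (hσd θ)
    have e : (κ (σ θ))⁻¹ • (κ (σ θ) • W (β (σ θ))) = W (β (σ θ)) := by
      rw [smul_smul, inv_mul_cancel₀ (hκ _).ne', one_smul]
    rw [e] at h
    exact h
  · simp only [hσadd, hβper]

/-! ### Regular bounded level curves in `ℝ³` -/

/-- **A bounded regular level curve carries a periodic trajectory of the renormalised tangent field.** Let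
`H : ℝ³ → ℝ²` and `V : ℝ³ → ℝ³` (`ℝ³ = EuclideanSpace ℝ (Fin 3)`) be `C¹` with `dH_y(V y) = 0` for all `y`,
`V ≠ 0` and `dH` onto at every point of `Γ = {H = 0}`, and let `Γ` be bounded. Then through every `p ∈ Γ`
passes a `T₀`-periodic solution of `β′ = κ(t) V(β)`, `κ` continuous positive `T₀`-periodic, lying in `Γ`
(transport of `LevelCurveData.injective_or_periodic` along `EuclideanSpace.equiv`; the injective alternative
contradicts `LevelCurveData.tendsto_norm_traj_atTop`). -/
theorem exists_scaled_periodic_of_regular_level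
    {H : EuclideanSpace ℝ (Fin 3) → (Fin 2 → ℝ)} {V : EuclideanSpace ℝ (Fin 3) → EuclideanSpace ℝ (Fin 3)}
    (hH : ContDiff ℝ 1 H) (hV : ContDiff ℝ 1 V) (hHV : ∀ y, fderiv ℝ H y (V y) = 0)
    (hne : ∀ y, H y = 0 → V y ≠ 0) (hsurj : ∀ y, H y = 0 → Function.Surjective (fderiv ℝ H y))
    {R : ℝ} (hbdd : ∀ y, H y = 0 → ‖y‖ ≤ R) {p : EuclideanSpace ℝ (Fin 3)} (hp : H p = 0) :
    ∃ (β : ℝ → EuclideanSpace ℝ (Fin 3)) (κ : ℝ → ℝ) (T₀ : ℝ), Continuous κ ∧ (∀ t, 0 < κ t) ∧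
      (∀ t, HasDerivAt β (κ t • V (β t)) t) ∧ 0 < T₀ ∧ (∀ t, β (t + T₀) = β t) ∧
      (∀ t, κ (t + T₀) = κ t) ∧ β 0 = p ∧ (∀ t, H (β t) = 0) := by
  set T : EuclideanSpace ℝ (Fin 3) ≃L[ℝ] (Fin 3 → ℝ) := EuclideanSpace.equiv (Fin 3) ℝ with hT
  -- the transported level-curve data on `Fin 3 → ℝ`
  have hfd : ∀ u : Fin 3 → ℝ, fderiv ℝ (H ∘ T.symm) u =
      (fderiv ℝ H (T.symm u)).comp (T.symm : (Fin 3 → ℝ) →L[ℝ] EuclideanSpace ℝ (Fin 3)) :=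
    fun u => T.symm.comp_right_fderiv
  set D : LevelCurveData 2 :=
    { H := H ∘ T.symm
      v := fun u => T (V (T.symm u))
      contDiff_H := hH.comp T.symm.contDiff
      contDiff_v := T.contDiff.comp (hV.comp T.symm.contDiff)
      fderiv_H_v := fun u => by
        rw [hfd u, ContinuousLinearMap.comp_apply, ContinuousLinearEquiv.coe_coe,
          ContinuousLinearEquiv.symm_apply_apply]
        exact hHV _
      v_ne_zero := fun u hu h0 => hne _ hu (by simpa using congrArg T.symm h0)
      surjective_fderiv := fun u hu => by
        rw [hfd u, ContinuousLinearMap.coe_comp]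
        exact (hsurj _ hu).comp T.symm.surjective } with hD
  set z : Fin 3 → ℝ := T p with hz
  have hzc : z ∈ D.curve := by
    change H (T.symm (T p)) = 0
    rw [ContinuousLinearEquiv.symm_apply_apply]; exact hp
  have hmem : ∀ t, H (T.symm (D.traj z t)) = 0 := fun t => D.traj_mem_curve hzc t
  rcases D.injective_or_periodic hzc with hinj | ⟨T₀, hT₀, hper, -⟩
  · -- an injective trajectory would leave the bounded set `Γ`
    exfalso
    have ht := D.tendsto_norm_traj_atTop hzc hinj
    set B : ℝ := ‖(T : EuclideanSpace ℝ (Fin 3) →L[ℝ] (Fin 3 → ℝ))‖ * R with hB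
    obtain ⟨t, hgt⟩ := (ht.eventually (eventually_gt_atTop B)).exists
    have hle : ‖D.traj z t‖ ≤ B := by
      have e : D.traj z t = T (T.symm (D.traj z t)) := (T.apply_symm_apply _).symm
      rw [e]
      refine ((T : EuclideanSpace ℝ (Fin 3) →L[ℝ] (Fin 3 → ℝ)).le_opNorm _).trans ?_
      exact mul_le_mul_of_nonneg_left (hbdd _ (hmem t)) (norm_nonneg _)
    linarith
  · refine ⟨fun t => T.symm (D.traj z t), fun t => D.nf (D.traj z t), T₀,
      D.contDiff_nf.continuous.comp (D.continuous_traj z), fun t => D.nf_pos _, fun t => ?_, hT₀,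
      fun t => by simp only [hper], fun t => by simp only [hper], by simp [hz], hmem⟩
    have h := ((T.symm : (Fin 3 → ℝ) →L[ℝ] EuclideanSpace ℝ (Fin 3)).hasFDerivAt).comp_hasDerivAt t
      (D.hasDerivAt_traj z t)
    have e : (T.symm : (Fin 3 → ℝ) →L[ℝ] EuclideanSpace ℝ (Fin 3)) (D.field (D.traj z t)) =
        D.nf (D.traj z t) • V (T.symm (D.traj z t)) := by
      change T.symm (D.nf (D.traj z t) • T (V (T.symm (D.traj z t)))) = _
      rw [map_smul, ContinuousLinearEquiv.symm_apply_apply]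
    rw [e] at h
    exact h

/-- **A bounded regular level curve carries a periodic orbit of its tangent field.** Same hypotheses;
conclusion for the field `V` itself: a periodic orbit `γ′ = V(γ)` with a period `ℓ > 0`, `γ 0 = p`,
inside `Γ` (time change of the previous statement). -/
theorem exists_periodic_orbit_of_regular_level
    {H : EuclideanSpace ℝ (Fin 3) → (Fin 2 → ℝ)} {V : EuclideanSpace ℝ (Fin 3) → EuclideanSpace ℝ (Fin 3)}
    (hH : ContDiff ℝ 1 H) (hV : ContDiff ℝ 1 V) (hHV : ∀ y, fderiv ℝ H y (V y) = 0)
    (hne : ∀ y, H y = 0 → V y ≠ 0) (hsurj : ∀ y, H y = 0 → Function.Surjective (fderiv ℝ H y))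
    {R : ℝ} (hbdd : ∀ y, H y = 0 → ‖y‖ ≤ R) {p : EuclideanSpace ℝ (Fin 3)} (hp : H p = 0) :
    ∃ (γ : ℝ → EuclideanSpace ℝ (Fin 3)) (ℓ : ℝ), 0 < ℓ ∧ (∀ θ, HasDerivAt γ (V (γ θ)) θ) ∧
      (∀ θ, γ (θ + ℓ) = γ θ) ∧ γ 0 = p ∧ (∀ θ, H (γ θ) = 0) := by
  obtain ⟨β, κ, T₀, hκc, hκ, hβ, hT₀, hβper, hκper, hβ0, hβH⟩ :=
    exists_scaled_periodic_of_regular_level hH hV hHV hne hsurj hbdd hp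
  obtain ⟨γ, ℓ, hℓ, hγ, hγper, hγ0, hγβ⟩ := exists_periodic_orbit_of_scaled hκc hκ hβ hT₀ hβper hκper
  refine ⟨γ, ℓ, hℓ, hγ, hγper, hγ0.trans hβ0, fun θ => ?_⟩
  obtain ⟨t, ht⟩ := hγβ θ
  rw [ht]; exact hβH t

end Summit.NavierStokesRegularity.NavierStokesRegularity.Theorems.LoopPeriodRatchetNoPlanarExtremumOrbit

end
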